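import Literature.NumberTheory.Sieve.KloostermanQuintilinearFrechetTools
import Literature.NumberTheory.Sieve.KloostermanQuintilinearSqrtTwoPartition
import Literature.NumberTheory.Sieve.SmoothPlateauCutoff
import Mathlib.Analysis.SpecialFunctions.Pow.Real
import HarnessLib

/-!
# Drappeau 2017, §4.3.3: the weight fed to Proposition 4.13, and its derivative bounds

Topic `Literature/NumberTheory/Sieve`.  In the proof of S. Drappeau, Proc. LMS (3) 114 (2017),
Theorem 2.1 (= the named fact `Literature.NumberTheory.Sieve.AssingBlomerLi2020_theorem23`) from
Proposition 4.13, after Poisson summation in `d` (`KloostermanQuintilinearCongruencesPoisson.lean`)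
and the substitution `x = θ·s·c·v`, `θ = D/(SC)` (`KloostermanQuintilinearCongruencesTools.lean`),
the frequencies `h` in a window `[a_j, 2a_j]` (`KloostermanQuintilinearSqrtTwoPartition.lean`)
contribute a sum of exactly the shape bounded by Proposition 4.13, with the weight

`W_{v,j}(c, h, n, r, s) = φ_j(h) · U(n/N) U(r/R) U(s/S) · g(c, θ v s c, n, r, s)`

(`U` a fixed plateau cut-off equal to `1` on `[1, 2]`).  Drappeau: "Proposition 4.13 can be applied
to the sums `𝒮(M₁, ξ, χ)`, at the cost of enlarging the bound by a factor `O((CDNRS)^{60ε₀})` in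
order for the derivative conditions (4.29) to be satisfied" (§4.3.3, p. 15 of the arXiv version).
This file constructs `W_{v,j}` (`weightW`) and PROVES everything Proposition 4.13 asks of it:
smoothness and compact support of the uncurried weight, the support box
`C ≤ c ≤ 2C`, `a_j ≤ h ≤ 2a_j`, `n, r, s > 0`, the plateau identity (the cut-offs are `1` on the
support of `b`), and the derivative conditions

`‖∂^ν W_{v,j}‖ ≤ Λ · C^{-ν₀} a_j^{-ν₁} N^{-ν₂} R^{-ν₃} S^{-ν₄}`,  `Λ = K · κ_W · (32·CDNRS)^{60ε₀}`

for all `ν` with `νᵢ ≤ 12`, from the hypotheses of Theorem 2.1 on `g` (the `(1−ε₀)`-weakened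
bounds `‖∂^ν g‖ ≤ K (c^{-ν₀}⋯s^{-ν₄})^{1−ε₀}` at positive arguments, orders `νᵢ ≤ 60`), via the
Fréchet calculus of `KloostermanQuintilinearMixedDerivCalculus.lean` / `…FrechetTools.lean`
(Schwarz symmetry, rescaling to unit scales, Leibniz, Faà di Bruno through `Φ_v`).

Everything PROVED; definitions with bodies (`cutU`, `weightW`, the numeric constant `kappaW`),
no named fact, standard axioms.

## References

* S. Drappeau, Proc. LMS (3) 114 (2017) 684–732, arXiv:1504.05549, §4.3.3 (the weight `g₁` and the
  loss `(CDNRS)^{60ε₀}`). [cite: Drappeau2017, §4.3.3]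
-/

noncomputable section

open scoped ContDiff BigOperators Topology
open Function Finset Filter Real

namespace Literature.NumberTheory.Sieve

namespace KloostermanQuintilinear

open Literature.NumberTheory.Sieve.SmoothWeights (stC stC_nonneg)
open BFI (derivConst one_le_derivConst)

/-! ### The cut-off and the weight -/

/-- The plateau cut-off `U = plateauCutoff 1 2 (1/2)`: smooth, `= 1` on `[1, 2]`, `= 0` off
`(1/2, 5/2)`, values in `[0, 1]`. [folklore] -/
def cutU (t : ℝ) : ℝ := plateauCutoff 1 2 (1 / 2) t

/-- `U = 1` on `[1, 2]`. [folklore] -/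
theorem cutU_eq_one {t : ℝ} (h1 : 1 ≤ t) (h2 : t ≤ 2) : cutU t = 1 :=
  plateauCutoff_eq_one (by norm_num) h1 h2

/-- `U(t) ≠ 0 ⟹ 1/2 < t < 5/2`. [folklore] -/
theorem cutU_ne_zero {t : ℝ} (h : cutU t ≠ 0) : 1 / 2 < t ∧ t < 5 / 2 := by
  constructor
  · by_contra hle
    exact h (plateauCutoff_eq_zero_of_le (by norm_num) (by norm_num) (by linarith))
  · by_contra hle
    exact h (plateauCutoff_eq_zero_of_ge (by norm_num) (by norm_num) (by linarith))

/-- `U` is smooth. [folklore] -/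
theorem contDiff_cutU : ContDiff ℝ ∞ cutU := contDiff_plateauCutoff 1 2 (1 / 2)

/-- `|U^{(i)}| ≤ 2 K_n 2^i` for `i ≤ n`. [folklore] -/
theorem norm_iteratedDeriv_cutU_le {i n : ℕ} (hi : i ≤ n) (t : ℝ) :
    ‖iteratedDeriv i cutU t‖ ≤ 2 * derivConst n * 2 ^ i := by
  have h := norm_iteratedDeriv_plateauCutoff_le_of_le hi (by norm_num : (0 : ℝ) < 1 / 2)
    (by norm_num : (1 : ℝ) ≤ 2) t
  have e : ((1 / 2 : ℝ)⁻¹) = 2 := by norm_num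
  rw [e] at h
  exact h

/-- **Drappeau's weight for Proposition 4.13** (after Poisson summation in `d`, the substitution
`x = θvsc`, `θ = D/(SC)`, and localisation of `h` to `[a_j, 2a_j]`):
`W_{v,j}(c,h,n,r,s) = φ_j(h) U(n/N) U(r/R) U(s/S) · g(c, θvsc, n, r, s)`.
[cite: Drappeau2017, §4.3.3] -/
def weightW (g : ℝ → ℝ → ℝ → ℝ → ℝ → ℂ) (C D N R S v : ℝ) (j : ℤ) :
    ℝ → ℝ → ℝ → ℝ → ℝ → ℂ :=
  fun c h n r s => ((sqrtTwoBump j h * cutU (n / N) * cutU (r / R) * cutU (s / S) : ℝ) : ℂ) *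
    g c (D / (S * C) * v * s * c) n r s

/-- **Plateau**: on `N ≤ n ≤ 2N`, `R ≤ r ≤ 2R`, `S ≤ s ≤ 2S` (in particular on the support of `b`),
`W_{v,j}(c,h,n,r,s) = φ_j(h) g(c, θvsc, n, r, s)`. [folklore] -/
theorem weightW_eq_of_mem {g : ℝ → ℝ → ℝ → ℝ → ℝ → ℂ} {C D N R S v : ℝ} {j : ℤ}
    (hN : 0 < N) (hR : 0 < R) (hS : 0 < S) {c h n r s : ℝ}
    (hn : N ≤ n ∧ n ≤ 2 * N) (hr : R ≤ r ∧ r ≤ 2 * R) (hs : S ≤ s ∧ s ≤ 2 * S) :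
    weightW g C D N R S v j c h n r s =
      (sqrtTwoBump j h : ℂ) * g c (D / (S * C) * v * s * c) n r s := by
  unfold weightW
  rw [cutU_eq_one ((one_le_div hN).mpr hn.1) ((div_le_iff₀ hN).mpr (by linarith)),
    cutU_eq_one ((one_le_div hR).mpr hr.1) ((div_le_iff₀ hR).mpr (by linarith)),
    cutU_eq_one ((one_le_div hS).mpr hs.1) ((div_le_iff₀ hS).mpr (by linarith))]
  simp

/-- **Support box** of `W_{v,j}`: if `g(c,d,n,r,s) ≠ 0 ⟹ C < c ≤ 2C`, then
`W_{v,j}(c,h,n,r,s) ≠ 0 ⟹ C ≤ c ≤ 2C ∧ a_j ≤ h ≤ 2a_j ∧ n, r, s > 0` (for `N, R, S > 0`). [folklore] -/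
theorem weightW_ne_zero {g : ℝ → ℝ → ℝ → ℝ → ℝ → ℂ} {C D N R S v : ℝ} {j : ℤ}
    (hN : 0 < N) (hR : 0 < R) (hS : 0 < S)
    (hsupp : ∀ c d n r s, g c d n r s ≠ 0 → C < c ∧ c ≤ 2 * C) {c h n r s : ℝ}
    (hW : weightW g C D N R S v j c h n r s ≠ 0) :
    (C ≤ c ∧ c ≤ 2 * C ∧ sqrtTwoScale j ≤ h ∧ h ≤ 2 * sqrtTwoScale j ∧ 0 < n ∧ 0 < r ∧ 0 < s) := by
  unfold weightW at hW
  obtain ⟨h1, h2⟩ := mul_ne_zero_iff.mp hW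
  have h1' : sqrtTwoBump j h * cutU (n / N) * cutU (r / R) * cutU (s / S) ≠ 0 := by
    exact_mod_cast h1
  obtain ⟨h123, h4⟩ := mul_ne_zero_iff.mp h1'
  obtain ⟨h12, h3⟩ := mul_ne_zero_iff.mp h123
  obtain ⟨hb, hc2⟩ := mul_ne_zero_iff.mp h12
  obtain ⟨hC1, hC2⟩ := hsupp _ _ _ _ _ h2
  obtain ⟨hh1, hh2⟩ := sqrtTwoBump_ne_zero hb
  have hn' := (cutU_ne_zero hc2).1
  have hr' := (cutU_ne_zero h3).1
  have hs' := (cutU_ne_zero h4).1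
  refine ⟨hC1.le, hC2, hh1.le, hh2.le, ?_, ?_, ?_⟩
  · have : 0 < n / N := by linarith
    exact (div_pos_iff_of_pos_right hN).mp this
  · have : 0 < r / R := by linarith
    exact (div_pos_iff_of_pos_right hR).mp this
  · have : 0 < s / S := by linarith
    exact (div_pos_iff_of_pos_right hS).mp this

/-! ### The uncurried weight: product structure, smoothness, compact support -/

/-- The real cut-off factor on `ℝ⁵`. [folklore] -/
def cutFactor (N R S : ℝ) (j : ℤ) (p : R5) : ℝ :=
  sqrtTwoBump j (p 1) * cutU (p 2 / N) * cutU (p 3 / R) * cutU (p 4 / S)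

/-- `U5 W = (cut factor) · (U5 g) ∘ Φ_{θv}`. [folklore] -/
theorem U5_weightW (g : ℝ → ℝ → ℝ → ℝ → ℝ → ℂ) (C D N R S v : ℝ) (j : ℤ) :
    U5 (weightW g C D N R S v j) =
      fun p => (cutFactor N R S j p : ℂ) * U5 g (PhiV (D / (S * C) * v) p) := by
  funext p
  simp only [U5, weightW, cutFactor, PhiV_apply_zero, PhiV_apply_one, PhiV_apply_two,
    PhiV_apply_three, PhiV_apply_four]
  congr 2
  ring

/-- The cut factor is smooth. [folklore] -/
theorem contDiff_cutFactor (N R S : ℝ) (j : ℤ) : ContDiff ℝ ∞ (cutFactor N R S j) := by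
  unfold cutFactor
  have h1 : ContDiff ℝ ∞ (fun p : R5 => sqrtTwoBump j (p 1)) :=
    (contDiff_sqrtTwoBump j).comp (contDiff_apply ℝ ℝ 1)
  have hc : ∀ (l : Fin 5) (X : ℝ), ContDiff ℝ ∞ (fun p : R5 => cutU (p l / X)) := fun l X =>
    contDiff_cutU.comp ((contDiff_apply ℝ ℝ l).div_const X)
  exact ((h1.mul (hc 2 N)).mul (hc 3 R)).mul (hc 4 S)

/-- The complexified cut factor is smooth. [folklore] -/
theorem contDiff_cutFactorC (N R S : ℝ) (j : ℤ) :
    ContDiff ℝ ∞ (fun p : R5 => (cutFactor N R S j p : ℂ)) :=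
  Complex.ofRealCLM.contDiff.comp (contDiff_cutFactor N R S j)

/-- **Smoothness of the uncurried weight.** [folklore] -/
theorem contDiff_U5_weightW {g : ℝ → ℝ → ℝ → ℝ → ℝ → ℂ} (hg : ContDiff ℝ ∞ (U5 g))
    (C D N R S v : ℝ) (j : ℤ) : ContDiff ℝ ∞ (U5 (weightW g C D N R S v j)) := by
  rw [U5_weightW]
  exact (contDiff_cutFactorC N R S j).mul (hg.comp (contDiff_PhiV _))

/-- **Compact support of the uncurried weight.** [folklore] -/
theorem hasCompactSupport_U5_weightW {g : ℝ → ℝ → ℝ → ℝ → ℝ → ℂ} {C D N R S v : ℝ} {j : ℤ}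
    (hN : 0 < N) (hR : 0 < R) (hS : 0 < S)
    (hsupp : ∀ c d n r s, g c d n r s ≠ 0 → C < c ∧ c ≤ 2 * C) :
    HasCompactSupport (U5 (weightW g C D N R S v j)) := by
  -- the support lies in a compact box
  set lo : R5 := ![C, sqrtTwoScale j, 0, 0, 0] with hlo
  set hi : R5 := ![2 * C, 2 * sqrtTwoScale j, 5 / 2 * N, 5 / 2 * R, 5 / 2 * S] with hhi
  refine HasCompactSupport.of_support_subset_isCompact (isCompact_Icc (a := lo) (b := hi)) ?_
  intro p hp
  rw [Function.mem_support, U5] at hp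
  have hbox := weightW_ne_zero hN hR hS hsupp hp
  -- the cut-offs also bound `n, r, s` from above
  unfold weightW at hp
  obtain ⟨h1, _⟩ := mul_ne_zero_iff.mp hp
  have h1' : sqrtTwoBump j (p 1) * cutU (p 2 / N) * cutU (p 3 / R) * cutU (p 4 / S) ≠ 0 := by
    exact_mod_cast h1
  obtain ⟨h123, h4⟩ := mul_ne_zero_iff.mp h1'
  obtain ⟨h12, h3⟩ := mul_ne_zero_iff.mp h123
  obtain ⟨_, hc2⟩ := mul_ne_zero_iff.mp h12
  have hn' := (cutU_ne_zero hc2).2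
  have hr' := (cutU_ne_zero h3).2
  have hs' := (cutU_ne_zero h4).2
  rw [div_lt_iff₀ hN] at hn'
  rw [div_lt_iff₀ hR] at hr'
  rw [div_lt_iff₀ hS] at hs'
  obtain ⟨b0, b0', b1, b1', b2, b3, b4⟩ := hbox
  constructor
  · intro l
    fin_cases l <;> simp [hlo] <;> linarith
  · intro l
    fin_cases l <;> simp [hhi] <;> linarith

/-! ### Rescaling to unit scales -/

/-- Product of a function over the sorted word. [folklore] -/
theorem prod_map_sortedWord (ν : Fin 5 → ℕ) (f : Fin 5 → ℂ) :
    ((sortedWord ν).map f).prod = f 0 ^ ν 0 * f 1 ^ ν 1 * f 2 ^ ν 2 * f 3 ^ ν 3 * f 4 ^ ν 4 := by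
  simp [sortedWord, List.prod_replicate, mul_assoc]

/-- **Rescaling of the nested derivative**: for a smooth five-variable `W` and positive scales
`a`, `∂^ν W (x) = (∏ aᵢ^{νᵢ})⁻¹ · ∂_{sorted ν} (U5 W ∘ scale a)(a⁻¹ ⊙ x)`, hence
`‖∂^ν W (x)‖ ≤ (∏ aᵢ^{νᵢ})⁻¹ ‖D^{|ν|}(U5 W ∘ scale a)(a⁻¹ ⊙ x)‖`. [folklore] -/
theorem norm_mixedDeriv_le_rescaled {W : ℝ → ℝ → ℝ → ℝ → ℝ → ℂ} (hW : ContDiff ℝ ∞ (U5 W))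
    (a : R5) (ha : ∀ i, 0 < a i) (ν : Fin 5 → ℕ) {k : ℕ} (hk : ν 0 + ν 1 + ν 2 + ν 3 + ν 4 = k)
    (x : R5) :
    ‖mixedDeriv ν W (x 0) (x 1) (x 2) (x 3) (x 4)‖ ≤
      (a 0 ^ ν 0 * a 1 ^ ν 1 * a 2 ^ ν 2 * a 3 ^ ν 3 * a 4 ^ ν 4)⁻¹ *
        ‖iteratedFDeriv ℝ k (fun y => U5 W (scale5 a y)) (fun i => (a i)⁻¹ * x i)‖ := by
  set y : R5 := fun i => (a i)⁻¹ * x i with hy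
  have hxy : scale5 a y = x := by
    funext i
    rw [scale5_apply, hy]
    simp only
    rw [← mul_assoc, mul_inv_cancel₀ (ha i).ne', one_mul]
  have h1 : mixedDeriv ν W (x 0) (x 1) (x 2) (x 3) (x 4) = wordDeriv (sortedWord ν) (U5 W) x :=
    mixedDeriv_eq_wordDeriv' W hW ν x
  have h2 := congrFun (wordDeriv_comp_scale5 hW a (sortedWord ν)) y
  rw [hxy, prod_map_sortedWord] at h2
  -- `h2 : wordDeriv (sortedWord ν) (U5 W ∘ scale a) y = (∏ aᵢ^νᵢ : ℂ) * wordDeriv (sortedWord ν) (U5 W) x`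
  have hP : ((a 0 : ℂ) ^ ν 0 * (a 1 : ℂ) ^ ν 1 * (a 2 : ℂ) ^ ν 2 * (a 3 : ℂ) ^ ν 3 * (a 4 : ℂ) ^ ν 4) =
      ((a 0 ^ ν 0 * a 1 ^ ν 1 * a 2 ^ ν 2 * a 3 ^ ν 3 * a 4 ^ ν 4 : ℝ) : ℂ) := by push_cast; ring
  have hPpos : 0 < a 0 ^ ν 0 * a 1 ^ ν 1 * a 2 ^ ν 2 * a 3 ^ ν 3 * a 4 ^ ν 4 := by
    have := ha 0; have := ha 1; have := ha 2; have := ha 3; have := ha 4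
    positivity
  have h3 : wordDeriv (sortedWord ν) (U5 W) x =
      ((a 0 ^ ν 0 * a 1 ^ ν 1 * a 2 ^ ν 2 * a 3 ^ ν 3 * a 4 ^ ν 4 : ℝ) : ℂ)⁻¹ *
        wordDeriv (sortedWord ν) (fun y => U5 W (scale5 a y)) y := by
    rw [h2, hP, ← mul_assoc, inv_mul_cancel₀ (by exact_mod_cast hPpos.ne'), one_mul]
  rw [h1, h3, norm_mul, norm_inv, Complex.norm_real, Real.norm_of_nonneg hPpos.le]
  refine mul_le_mul_of_nonneg_left ?_ (by positivity)
  have hsc : ContDiff ℝ ∞ (fun y => U5 W (scale5 a y)) := contDiff_comp_scale5 hW a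
  have := norm_wordDeriv_le_norm_iteratedFDeriv hsc (sortedWord ν) y
  rw [length_sortedWord, hk] at this
  exact this

/-! ### Derivative bounds: the constants -/

/-- `Σ_{i ≤ 60} stC i`, a common bound for `stC i`, `i ≤ 60`. [folklore] -/
def stCSum : ℝ := ∑ i ∈ Finset.range 61, stC i

/-- `stC i ≤ stCSum` for `i ≤ 60`. [folklore] -/
theorem stC_le_stCSum {i : ℕ} (hi : i ≤ 60) : stC i ≤ stCSum :=
  Finset.single_le_sum (f := stC) (fun j _ => stC_nonneg j) (Finset.mem_range.2 (by omega))

/-- `stCSum ≥ 0`. [folklore] -/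
theorem stCSum_nonneg : 0 ≤ stCSum := Finset.sum_nonneg fun j _ => stC_nonneg j

/-- Uniform bound for the derivatives of order `≤ 60` of the rescaled bumps `t ↦ φ_j(a_j t)`.
[folklore] -/
def betaBump : ℝ := 2 * stCSum * ((Real.sqrt 2 - 1)⁻¹) ^ 60

/-- Uniform bound for the derivatives of order `≤ 60` of the cut-off `U`. [folklore] -/
def betaCut : ℝ := 2 * derivConst 60 * 2 ^ 60

/-- `betaBump ≥ 0`. [folklore] -/
theorem betaBump_nonneg : 0 ≤ betaBump := by
  unfold betaBump
  have := sqrt_two_sub_one_pos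
  have := stCSum_nonneg
  positivity

/-- `betaCut ≥ 1`. [folklore] -/
theorem one_le_betaCut : 1 ≤ betaCut := by
  unfold betaCut
  have h1 := one_le_derivConst 60
  have h2 : (1 : ℝ) ≤ 2 ^ 60 := one_le_pow₀ (by norm_num)
  nlinarith

/-- **The numeric constant `κ_W`** of the derivative bounds of `W_{v,j}`. [folklore] -/
def kappaW : ℝ :=
  2 ^ 60 * (8 ^ 60 * betaBump * betaCut ^ 3) * ((Nat.factorial 60 : ℝ) * 15 ^ 60 * 10 ^ 60)

/-- `κ_W ≥ 0`. [folklore] -/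
theorem kappaW_nonneg : 0 ≤ kappaW := by
  unfold kappaW
  have := betaBump_nonneg
  have := one_le_betaCut
  positivity

/-! ### Derivative bounds: the one-variable factors -/

/-- `(√2 − 1)⁻¹ ≥ 1`. [folklore] -/
theorem one_le_inv_sqrt_two_sub_one : (1 : ℝ) ≤ (Real.sqrt 2 - 1)⁻¹ := by
  rw [one_le_inv_iff₀]
  refine ⟨sqrt_two_sub_one_pos, ?_⟩
  have : Real.sqrt 2 ≤ 2 := by
    rw [show (2 : ℝ) = Real.sqrt 4 by
      rw [show (4 : ℝ) = 2 ^ 2 by norm_num, Real.sqrt_sq (by norm_num)]]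
    exact Real.sqrt_le_sqrt (by norm_num)
  linarith

/-- Complexification does not change the size of derivatives. [folklore] -/
theorem norm_iteratedDeriv_ofReal_comp {f : ℝ → ℝ} (hf : ContDiff ℝ ∞ f) (i : ℕ) (t : ℝ) :
    ‖iteratedDeriv i (fun t => (f t : ℂ)) t‖ = ‖iteratedDeriv i f t‖ := by
  rw [← norm_iteratedFDeriv_eq_norm_iteratedDeriv (𝕜 := ℝ),
    ← norm_iteratedFDeriv_eq_norm_iteratedDeriv (𝕜 := ℝ)]
  have hfun : (fun t => (f t : ℂ)) = Complex.ofRealLI ∘ f := by funext t; rfl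
  rw [hfun]
  exact LinearIsometry.norm_iteratedFDeriv_comp_left Complex.ofRealLI hf.contDiffAt (i := i)
    (by exact_mod_cast le_top)

/-- **The rescaled bump factor**: `|(t ↦ φ_j(a_j t))^{(i)}| ≤ betaBump` for `i ≤ 60`. [folklore] -/
theorem norm_iteratedDeriv_bump_rescaled_le (j : ℤ) {i : ℕ} (hi : i ≤ 60) (t : ℝ) :
    ‖iteratedDeriv i (fun t => sqrtTwoBump j (sqrtTwoScale j * t)) t‖ ≤ betaBump := by
  have hM := sqrtTwoScale_pos j
  have hcd : ContDiff ℝ i (sqrtTwoBump j) := contDiff_sqrtTwoBump j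
  rw [congrFun (iteratedDeriv_comp_const_mul hcd (sqrtTwoScale j)) t, norm_mul, norm_pow,
    Real.norm_of_nonneg hM.le]
  refine (mul_le_mul_of_nonneg_left (norm_iteratedDeriv_sqrtTwoBump_le j i _) (by positivity)).trans ?_
  have hq1 := one_le_inv_sqrt_two_sub_one
  have e1 : sqrtTwoScale j ^ i * (2 * (stC i * (Real.sqrt 2 - 1)⁻¹ ^ i * (sqrtTwoScale j)⁻¹ ^ i)) =
      2 * stC i * (Real.sqrt 2 - 1)⁻¹ ^ i := by
    have hu : sqrtTwoScale j ^ i * (sqrtTwoScale j)⁻¹ ^ i = 1 := by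
      rw [← mul_pow, mul_inv_cancel₀ hM.ne', one_pow]
    calc sqrtTwoScale j ^ i * (2 * (stC i * (Real.sqrt 2 - 1)⁻¹ ^ i * (sqrtTwoScale j)⁻¹ ^ i))
        = 2 * stC i * (Real.sqrt 2 - 1)⁻¹ ^ i * (sqrtTwoScale j ^ i * (sqrtTwoScale j)⁻¹ ^ i) := by
          ring
      _ = 2 * stC i * (Real.sqrt 2 - 1)⁻¹ ^ i := by rw [hu, mul_one]
  rw [e1]
  unfold betaBump
  have h1 : stC i ≤ stCSum := stC_le_stCSum hi
  have h2 : (Real.sqrt 2 - 1)⁻¹ ^ i ≤ (Real.sqrt 2 - 1)⁻¹ ^ 60 := pow_le_pow_right₀ hq1 hi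
  have h3 : 0 ≤ (Real.sqrt 2 - 1)⁻¹ ^ i := by positivity
  have h4 := stC_nonneg i
  calc 2 * stC i * (Real.sqrt 2 - 1)⁻¹ ^ i ≤ 2 * stCSum * (Real.sqrt 2 - 1)⁻¹ ^ i := by
        gcongr
    _ ≤ 2 * stCSum * (Real.sqrt 2 - 1)⁻¹ ^ 60 := by
        have := stCSum_nonneg
        gcongr

/-- **The cut-off factor**: `|U^{(i)}| ≤ betaCut` for `i ≤ 60`. [folklore] -/
theorem norm_iteratedDeriv_cutU_le_betaCut {i : ℕ} (hi : i ≤ 60) (t : ℝ) :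
    ‖iteratedDeriv i cutU t‖ ≤ betaCut := by
  refine (norm_iteratedDeriv_cutU_le hi t).trans ?_
  unfold betaCut
  have h1 := one_le_derivConst 60
  have h2 : (2 : ℝ) ^ i ≤ 2 ^ 60 := pow_le_pow_right₀ (by norm_num) hi
  gcongr

/-- The complexified one-variable factor `y ↦ f(y_l)` on `ℝ⁵`: all derivatives of order `≤ 60`
are bounded by the uniform bound of `f`. [folklore] -/
theorem norm_iteratedFDeriv_coordFactor_le {f : ℝ → ℝ} (hf : ContDiff ℝ ∞ f) {β : ℝ}
    (hβ : ∀ i, i ≤ 60 → ∀ t, ‖iteratedDeriv i f t‖ ≤ β) (l : Fin 5) (y : R5) :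
    ∀ i, i ≤ 60 → ‖iteratedFDeriv ℝ i (fun y : R5 => ((f (y l) : ℝ) : ℂ)) y‖ ≤ β := by
  intro i hi
  have hfC : ContDiff ℝ ∞ (fun t => (f t : ℂ)) := Complex.ofRealCLM.contDiff.comp hf
  refine (norm_iteratedFDeriv_comp_coord_le hfC l i y).trans ?_
  rw [norm_iteratedDeriv_ofReal_comp hf]
  exact hβ i hi _

/-- **All derivatives of order `≤ 60` of the rescaled cut factor are bounded by
`8⁶⁰ · betaBump · betaCut³`.** [folklore] -/
theorem norm_iteratedFDeriv_cutFactor_rescaled_le (j : ℤ) (y : R5) :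
    ∀ i, i ≤ 60 → ‖iteratedFDeriv ℝ i (fun y : R5 =>
        ((sqrtTwoBump j (sqrtTwoScale j * y 1) * cutU (y 2) * cutU (y 3) * cutU (y 4) : ℝ) : ℂ)) y‖ ≤
      8 ^ 60 * betaBump * betaCut ^ 3 := by
  -- the four factors
  set G1 : R5 → ℂ := fun y => ((sqrtTwoBump j (sqrtTwoScale j * y 1) : ℝ) : ℂ) with hG1
  set G2 : R5 → ℂ := fun y => ((cutU (y 2) : ℝ) : ℂ) with hG2
  set G3 : R5 → ℂ := fun y => ((cutU (y 3) : ℝ) : ℂ) with hG3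
  set G4 : R5 → ℂ := fun y => ((cutU (y 4) : ℝ) : ℂ) with hG4
  have hfun : (fun y : R5 =>
      ((sqrtTwoBump j (sqrtTwoScale j * y 1) * cutU (y 2) * cutU (y 3) * cutU (y 4) : ℝ) : ℂ)) =
      fun y => ((G1 y * G2 y) * G3 y) * G4 y := by
    funext y; simp only [hG1, hG2, hG3, hG4]; push_cast; ring
  have hb : ContDiff ℝ ∞ (fun t => sqrtTwoBump j (sqrtTwoScale j * t)) :=
    (contDiff_sqrtTwoBump j).comp (contDiff_const.mul contDiff_id)
  have s1 : ContDiff ℝ ∞ G1 :=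
    (Complex.ofRealCLM.contDiff.comp hb).comp (contDiff_apply ℝ ℝ 1)
  have sc : ∀ l : Fin 5, ContDiff ℝ ∞ (fun y : R5 => ((cutU (y l) : ℝ) : ℂ)) := fun l =>
    (Complex.ofRealCLM.contDiff.comp contDiff_cutU).comp (contDiff_apply ℝ ℝ l)
  have b1 : ∀ i, i ≤ 60 → ‖iteratedFDeriv ℝ i G1 y‖ ≤ betaBump :=
    norm_iteratedFDeriv_coordFactor_le hb (fun i hi t => norm_iteratedDeriv_bump_rescaled_le j hi t) 1 y
  have b2 : ∀ i, i ≤ 60 → ‖iteratedFDeriv ℝ i G2 y‖ ≤ betaCut :=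
    norm_iteratedFDeriv_coordFactor_le contDiff_cutU (fun i hi t => norm_iteratedDeriv_cutU_le_betaCut hi t) 2 y
  have b3 : ∀ i, i ≤ 60 → ‖iteratedFDeriv ℝ i G3 y‖ ≤ betaCut :=
    norm_iteratedFDeriv_coordFactor_le contDiff_cutU (fun i hi t => norm_iteratedDeriv_cutU_le_betaCut hi t) 3 y
  have b4 : ∀ i, i ≤ 60 → ‖iteratedFDeriv ℝ i G4 y‖ ≤ betaCut :=
    norm_iteratedFDeriv_coordFactor_le contDiff_cutU (fun i hi t => norm_iteratedDeriv_cutU_le_betaCut hi t) 4 y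
  have hβ1 := betaBump_nonneg
  have hβ2 : 0 ≤ betaCut := zero_le_one.trans one_le_betaCut
  have b12 := norm_iteratedFDeriv_mul_le_of_le s1 (sc 2) hβ1 hβ2 b1 b2
  have b123 := norm_iteratedFDeriv_mul_le_of_le (s1.mul (sc 2)) (sc 3) (by positivity) hβ2 b12 b3
  have b1234 := norm_iteratedFDeriv_mul_le_of_le ((s1.mul (sc 2)).mul (sc 3)) (sc 4) (by positivity)
    hβ2 b123 b4
  rw [hfun]
  intro i hi
  refine (b1234 i hi).trans (le_of_eq ?_)
  ring

/-! ### Derivative bounds: the factor `g` through `Φ_v` -/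

/-- One coordinate of the loss computation:
`b^ν ((bz)^{-ν})^{1-ε₀} ≤ P^{νε₀} 2^ν` for `0 < b ≤ P`, `P ≥ 1`, `z ≥ 1/2`, `0 ≤ ε₀ ≤ 1`. [folklore] -/
theorem coord_loss_le {b z P ε₀ : ℝ} {ν : ℕ} (hb : 0 < b) (hbP : b ≤ P) (hP : 1 ≤ P)
    (hz : 1 / 2 ≤ z) (hε₀ : 0 ≤ ε₀) (hε₁ : ε₀ ≤ 1) :
    b ^ ν * ((b * z) ^ (-(ν : ℝ))) ^ (1 - ε₀) ≤ P ^ ((ν : ℝ) * ε₀) * 2 ^ ν := by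
  have hz0 : 0 < z := by linarith
  have hbz : 0 < b * z := mul_pos hb hz0
  -- rewrite the left-hand side as `b^{νε₀} z^{-ν(1-ε₀)}`
  have e1 : ((b * z) ^ (-(ν : ℝ))) ^ (1 - ε₀) = b ^ (-(ν : ℝ) * (1 - ε₀)) * z ^ (-(ν : ℝ) * (1 - ε₀)) := by
    rw [← Real.rpow_mul hbz.le, Real.mul_rpow hb.le hz0.le]
  have e2 : (b : ℝ) ^ ν * b ^ (-(ν : ℝ) * (1 - ε₀)) = b ^ ((ν : ℝ) * ε₀) := by
    rw [← Real.rpow_natCast b ν, ← Real.rpow_add hb]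
    congr 1; ring
  rw [e1, ← mul_assoc, e2]
  refine mul_le_mul ?_ ?_ (by positivity) (by positivity)
  · exact Real.rpow_le_rpow hb.le hbP (by positivity)
  · -- `z^{-ν(1-ε₀)} ≤ (1/2)^{-ν(1-ε₀)} = 2^{ν(1-ε₀)} ≤ 2^ν`
    have hexp : -(ν : ℝ) * (1 - ε₀) ≤ 0 := by
      have : (0 : ℝ) ≤ ν := Nat.cast_nonneg ν
      nlinarith
    calc z ^ (-(ν : ℝ) * (1 - ε₀)) ≤ (1 / 2 : ℝ) ^ (-(ν : ℝ) * (1 - ε₀)) :=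
          Real.rpow_le_rpow_of_nonpos (by norm_num) hz hexp
      _ = (2 : ℝ) ^ ((ν : ℝ) * (1 - ε₀)) := by
          rw [one_div, Real.inv_rpow (by norm_num), ← Real.rpow_neg (by norm_num)]
          congr 1; ring
      _ ≤ (2 : ℝ) ^ (ν : ℝ) := by
          refine Real.rpow_le_rpow_of_exponent_le one_le_two ?_
          have : (0 : ℝ) ≤ ν := Nat.cast_nonneg ν
          nlinarith
      _ = 2 ^ ν := Real.rpow_natCast 2 ν

/-- **Word derivatives of the rescaled weight `g♭ = U5 g ∘ scale b`** (`b = (C, D, N, R, S)`) in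
the box `[1/2, 5/2]⁵`: `|∂_w g♭(z)| ≤ K · 2⁶⁰ · P^{60ε₀}` for `|w| ≤ 60`, `P = 32·CDNRS`.
[cite: Drappeau2017, §4.3.3] -/
theorem norm_wordDeriv_gflat_le {g : ℝ → ℝ → ℝ → ℝ → ℝ → ℂ} (hg : ContDiff ℝ ∞ (U5 g))
    {b : R5} (hb : ∀ i, 0 < b i) {P : ℝ} (hP : 1 ≤ P) (hbP : ∀ i, b i ≤ P)
    {K ε₀ : ℝ} (hK : 0 ≤ K) (hε₀ : 0 ≤ ε₀) (hε₁ : ε₀ ≤ 1)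
    (hder : ∀ ν : Fin 5 → ℕ, (∀ i, ν i ≤ 60) → ∀ c d n r s : ℝ, 0 < c → 0 < d → 0 < n → 0 < r →
      0 < s → ‖mixedDeriv ν g c d n r s‖ ≤ K * (c ^ (-(ν 0 : ℝ)) * d ^ (-(ν 1 : ℝ)) *
        n ^ (-(ν 2 : ℝ)) * r ^ (-(ν 3 : ℝ)) * s ^ (-(ν 4 : ℝ))) ^ (1 - ε₀))
    {z : R5} (hz : ∀ i, 1 / 2 ≤ z i) (w : List (Fin 5)) (hw : w.length ≤ 60) :
    ‖wordDeriv w (fun z => U5 g (scale5 b z)) z‖ ≤ K * 2 ^ 60 * P ^ (60 * ε₀) := by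
  set ν : Fin 5 → ℕ := fun i => w.count i with hν
  have hperm : w.Perm (sortedWord ν) := perm_sortedWord_count w
  have hlen : ν 0 + ν 1 + ν 2 + ν 3 + ν 4 = w.length := by
    rw [← length_sortedWord, hperm.length_eq]
  have hνle : ∀ i, ν i ≤ 60 := by
    intro i
    have : ν i ≤ ν 0 + ν 1 + ν 2 + ν 3 + ν 4 := by fin_cases i <;> simp <;> omega
    omega
  have hgs : ContDiff ℝ ∞ (fun z => U5 g (scale5 b z)) := contDiff_comp_scale5 hg b
  -- to the sorted word, then rescale, then to `mixedDeriv`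
  rw [congrFun (wordDeriv_perm hgs hperm) z, congrFun (wordDeriv_comp_scale5 hg b (sortedWord ν)) z,
    prod_map_sortedWord, ← mixedDeriv_eq_wordDeriv' g hg ν (scale5 b z)]
  simp only [scale5_apply]
  have hpos : ∀ i, 0 < b i * z i := fun i => mul_pos (hb i) (by linarith [hz i])
  have hd := hder ν hνle (b 0 * z 0) (b 1 * z 1) (b 2 * z 2) (b 3 * z 3) (b 4 * z 4)
    (hpos 0) (hpos 1) (hpos 2) (hpos 3) (hpos 4)
  rw [norm_mul]
  have hnormP : ‖((b 0 : ℂ)) ^ ν 0 * (b 1 : ℂ) ^ ν 1 * (b 2 : ℂ) ^ ν 2 * (b 3 : ℂ) ^ ν 3 * (b 4 : ℂ) ^ ν 4‖ =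
      b 0 ^ ν 0 * b 1 ^ ν 1 * b 2 ^ ν 2 * b 3 ^ ν 3 * b 4 ^ ν 4 := by
    have e : ((b 0 : ℂ)) ^ ν 0 * (b 1 : ℂ) ^ ν 1 * (b 2 : ℂ) ^ ν 2 * (b 3 : ℂ) ^ ν 3 * (b 4 : ℂ) ^ ν 4 =
        ((b 0 ^ ν 0 * b 1 ^ ν 1 * b 2 ^ ν 2 * b 3 ^ ν 3 * b 4 ^ ν 4 : ℝ) : ℂ) := by push_cast; ring
    rw [e, Complex.norm_real, Real.norm_of_nonneg]
    have := hb 0; have := hb 1; have := hb 2; have := hb 3; have := hb 4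
    positivity
  rw [hnormP]
  -- combine coordinatewise
  have hprod_nonneg : 0 ≤ b 0 ^ ν 0 * b 1 ^ ν 1 * b 2 ^ ν 2 * b 3 ^ ν 3 * b 4 ^ ν 4 := by
    have := hb 0; have := hb 1; have := hb 2; have := hb 3; have := hb 4
    positivity
  calc b 0 ^ ν 0 * b 1 ^ ν 1 * b 2 ^ ν 2 * b 3 ^ ν 3 * b 4 ^ ν 4 *
        ‖mixedDeriv ν g (b 0 * z 0) (b 1 * z 1) (b 2 * z 2) (b 3 * z 3) (b 4 * z 4)‖
      ≤ b 0 ^ ν 0 * b 1 ^ ν 1 * b 2 ^ ν 2 * b 3 ^ ν 3 * b 4 ^ ν 4 *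
        (K * ((b 0 * z 0) ^ (-(ν 0 : ℝ)) * (b 1 * z 1) ^ (-(ν 1 : ℝ)) * (b 2 * z 2) ^ (-(ν 2 : ℝ)) *
          (b 3 * z 3) ^ (-(ν 3 : ℝ)) * (b 4 * z 4) ^ (-(ν 4 : ℝ))) ^ (1 - ε₀)) :=
        mul_le_mul_of_nonneg_left hd hprod_nonneg
    _ = K * ((b 0 ^ ν 0 * ((b 0 * z 0) ^ (-(ν 0 : ℝ))) ^ (1 - ε₀)) *
          (b 1 ^ ν 1 * ((b 1 * z 1) ^ (-(ν 1 : ℝ))) ^ (1 - ε₀)) *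
          (b 2 ^ ν 2 * ((b 2 * z 2) ^ (-(ν 2 : ℝ))) ^ (1 - ε₀)) *
          (b 3 ^ ν 3 * ((b 3 * z 3) ^ (-(ν 3 : ℝ))) ^ (1 - ε₀)) *
          (b 4 ^ ν 4 * ((b 4 * z 4) ^ (-(ν 4 : ℝ))) ^ (1 - ε₀))) := by
        have h0 : ∀ i, 0 ≤ (b i * z i) ^ (-(ν i : ℝ)) := fun i => Real.rpow_nonneg (hpos i).le _
        rw [Real.mul_rpow (by have := h0 0; have := h0 1; have := h0 2; have := h0 3; positivity) (h0 4),
          Real.mul_rpow (by have := h0 0; have := h0 1; have := h0 2; positivity) (h0 3),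
          Real.mul_rpow (by have := h0 0; have := h0 1; positivity) (h0 2),
          Real.mul_rpow (h0 0) (h0 1)]
        ring
    _ ≤ K * ((P ^ ((ν 0 : ℝ) * ε₀) * 2 ^ ν 0) * (P ^ ((ν 1 : ℝ) * ε₀) * 2 ^ ν 1) *
          (P ^ ((ν 2 : ℝ) * ε₀) * 2 ^ ν 2) * (P ^ ((ν 3 : ℝ) * ε₀) * 2 ^ ν 3) *
          (P ^ ((ν 4 : ℝ) * ε₀) * 2 ^ ν 4)) := by
        have hc : ∀ i, b i ^ ν i * ((b i * z i) ^ (-(ν i : ℝ))) ^ (1 - ε₀) ≤ P ^ ((ν i : ℝ) * ε₀) * 2 ^ ν i :=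
          fun i => coord_loss_le (hb i) (hbP i) hP (hz i) hε₀ hε₁
        have hn : ∀ i, 0 ≤ b i ^ ν i * ((b i * z i) ^ (-(ν i : ℝ))) ^ (1 - ε₀) := fun i => by
          have := hb i; have := Real.rpow_nonneg (hpos i).le (-(ν i : ℝ)); positivity
        refine mul_le_mul_of_nonneg_left ?_ hK
        have := hc 0; have := hc 1; have := hc 2; have := hc 3; have := hc 4
        have := hn 0; have := hn 1; have := hn 2; have := hn 3; have := hn 4
        gcongr
    _ = K * (P ^ (((ν 0 + ν 1 + ν 2 + ν 3 + ν 4 : ℕ) : ℝ) * ε₀) * 2 ^ (ν 0 + ν 1 + ν 2 + ν 3 + ν 4)) := by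
        have hP0 : 0 < P := by linarith
        simp only [pow_add, Nat.cast_add, add_mul, Real.rpow_add hP0]
        ring
    _ ≤ K * (P ^ (60 * ε₀) * 2 ^ 60) := by
        refine mul_le_mul_of_nonneg_left ?_ hK
        have hle : ν 0 + ν 1 + ν 2 + ν 3 + ν 4 ≤ 60 := by omega
        refine mul_le_mul ?_ (pow_le_pow_right₀ (by norm_num) hle) (by positivity) (by positivity)
        refine Real.rpow_le_rpow_of_exponent_le hP ?_
        have : ((ν 0 + ν 1 + ν 2 + ν 3 + ν 4 : ℕ) : ℝ) ≤ 60 := by exact_mod_cast hle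
        nlinarith
    _ = K * 2 ^ 60 * P ^ (60 * ε₀) := by ring

/-- **Fréchet derivatives of `g♭` in the box**: `‖Dˡ g♭(z)‖ ≤ K·10⁶⁰·P^{60ε₀}` for `l ≤ 60`.
[cite: Drappeau2017, §4.3.3] -/
theorem norm_iteratedFDeriv_gflat_le {g : ℝ → ℝ → ℝ → ℝ → ℝ → ℂ} (hg : ContDiff ℝ ∞ (U5 g))
    {b : R5} (hb : ∀ i, 0 < b i) {P : ℝ} (hP : 1 ≤ P) (hbP : ∀ i, b i ≤ P)
    {K ε₀ : ℝ} (hK : 0 ≤ K) (hε₀ : 0 ≤ ε₀) (hε₁ : ε₀ ≤ 1)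
    (hder : ∀ ν : Fin 5 → ℕ, (∀ i, ν i ≤ 60) → ∀ c d n r s : ℝ, 0 < c → 0 < d → 0 < n → 0 < r →
      0 < s → ‖mixedDeriv ν g c d n r s‖ ≤ K * (c ^ (-(ν 0 : ℝ)) * d ^ (-(ν 1 : ℝ)) *
        n ^ (-(ν 2 : ℝ)) * r ^ (-(ν 3 : ℝ)) * s ^ (-(ν 4 : ℝ))) ^ (1 - ε₀))
    {z : R5} (hz : ∀ i, 1 / 2 ≤ z i) {l : ℕ} (hl : l ≤ 60) :
    ‖iteratedFDeriv ℝ l (fun z => U5 g (scale5 b z)) z‖ ≤ K * 10 ^ 60 * P ^ (60 * ε₀) := by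
  have hgs : ContDiff ℝ ∞ (fun z => U5 g (scale5 b z)) := contDiff_comp_scale5 hg b
  have hB : 0 ≤ K * 2 ^ 60 * P ^ (60 * ε₀) := by
    have : 0 ≤ P ^ (60 * ε₀) := Real.rpow_nonneg (by linarith) _
    positivity
  refine (norm_iteratedFDeriv_le_of_wordDeriv hgs hB fun w => ?_).trans ?_
  · exact norm_wordDeriv_gflat_le hg hb hP hbP hK hε₀ hε₁ hder hz (List.ofFn w) (by simp [hl])
  · have h5 : (5 : ℝ) ^ l ≤ 5 ^ 60 := pow_le_pow_right₀ (by norm_num) hl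
    have hPe : 0 ≤ P ^ (60 * ε₀) := Real.rpow_nonneg (by linarith) _
    calc (5 : ℝ) ^ l * (K * 2 ^ 60 * P ^ (60 * ε₀)) ≤ 5 ^ 60 * (K * 2 ^ 60 * P ^ (60 * ε₀)) :=
          mul_le_mul_of_nonneg_right h5 hB
      _ = K * 10 ^ 60 * P ^ (60 * ε₀) := by
          rw [show (10 : ℝ) ^ 60 = 5 ^ 60 * 2 ^ 60 by norm_num]
          ring

/-! ### Derivative bounds: assembly -/

/-- Where the rescaled weight `y ↦ U5 W (a ⊙ y)`, `a = (C, a_j, N, R, S)`, does not vanish.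
[folklore] -/
theorem rescaled_weightW_ne_zero {g : ℝ → ℝ → ℝ → ℝ → ℝ → ℂ} {C D N R S v : ℝ} {j : ℤ}
    (hC : 0 < C) (hD : 0 < D) (hN : 0 < N) (hR : 0 < R) (hS : 0 < S)
    (hsupp : ∀ c d n r s, g c d n r s ≠ 0 → C < c ∧ c ≤ 2 * C ∧ D < d ∧ d ≤ 2 * D) {y : R5}
    (hy : U5 (weightW g C D N R S v j) (scale5 ![C, sqrtTwoScale j, N, R, S] y) ≠ 0) :
    y 0 ∈ Set.Icc (1 : ℝ) 2 ∧ y 1 ∈ Set.Icc (1 : ℝ) 2 ∧ y 2 ∈ Set.Icc (1 / 2 : ℝ) (5 / 2) ∧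
      y 3 ∈ Set.Icc (1 / 2 : ℝ) (5 / 2) ∧ y 4 ∈ Set.Icc (1 / 2 : ℝ) (5 / 2) ∧
      v * y 0 * y 4 ∈ Set.Icc (1 : ℝ) 2 := by
  have hM := sqrtTwoScale_pos j
  simp only [U5, weightW, scale5_apply, Matrix.cons_val_zero, Matrix.cons_val_one,
    Matrix.cons_val] at hy
  obtain ⟨h1, h2⟩ := mul_ne_zero_iff.mp hy
  have h1' : sqrtTwoBump j (sqrtTwoScale j * y 1) * cutU (N * y 2 / N) * cutU (R * y 3 / R) *
      cutU (S * y 4 / S) ≠ 0 := by exact_mod_cast h1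
  rw [mul_div_cancel_left₀ _ hN.ne', mul_div_cancel_left₀ _ hR.ne', mul_div_cancel_left₀ _ hS.ne']
    at h1'
  obtain ⟨h123, h4⟩ := mul_ne_zero_iff.mp h1'
  obtain ⟨h12, h3⟩ := mul_ne_zero_iff.mp h123
  obtain ⟨hb, hc2⟩ := mul_ne_zero_iff.mp h12
  obtain ⟨hb1, hb2⟩ := sqrtTwoBump_ne_zero hb
  obtain ⟨hg1, hg2, hg3, hg4⟩ := hsupp _ _ _ _ _ h2
  have hn := cutU_ne_zero hc2
  have hr := cutU_ne_zero h3
  have hs := cutU_ne_zero h4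
  have hd : D / (S * C) * v * (S * y 4) * (C * y 0) = D * (v * y 0 * y 4) := by
    field_simp
  rw [hd] at hg3 hg4
  refine ⟨⟨?_, ?_⟩, ⟨?_, ?_⟩, ⟨hn.1.le, hn.2.le⟩, ⟨hr.1.le, hr.2.le⟩, ⟨hs.1.le, hs.2.le⟩, ⟨?_, ?_⟩⟩
  · by_contra h; rw [not_le] at h; nlinarith
  · by_contra h; rw [not_le] at h; nlinarith
  · by_contra h; rw [not_le] at h; nlinarith
  · by_contra h; rw [not_le] at h; nlinarith
  · by_contra h; rw [not_le] at h; nlinarith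
  · by_contra h; rw [not_le] at h; nlinarith

/-- **Uniform bound for the Fréchet derivatives of order `≤ 60` of the rescaled weight**
`y ↦ U5 W_{v,j} (C y₀, a_j y₁, N y₂, R y₃, S y₄)`:  `≤ K · κ_W · (32 CDNRS)^{60ε₀}`.
[cite: Drappeau2017, §4.3.3] -/
theorem norm_iteratedFDeriv_rescaled_weightW_le {g : ℝ → ℝ → ℝ → ℝ → ℝ → ℂ}
    (hg : ContDiff ℝ ∞ (U5 g)) {C D N R S : ℝ} (hC : 1 ≤ C) (hD : 1 ≤ D) (hN : 1 / 2 ≤ N)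
    (hR : 1 ≤ R) (hS : 1 ≤ S)
    (hsupp : ∀ c d n r s, g c d n r s ≠ 0 → C < c ∧ c ≤ 2 * C ∧ D < d ∧ d ≤ 2 * D)
    {K ε₀ : ℝ} (hK : 0 ≤ K) (hε₀ : 0 ≤ ε₀) (hε₁ : ε₀ ≤ 1)
    (hder : ∀ ν : Fin 5 → ℕ, (∀ i, ν i ≤ 60) → ∀ c d n r s : ℝ, 0 < c → 0 < d → 0 < n → 0 < r →
      0 < s → ‖mixedDeriv ν g c d n r s‖ ≤ K * (c ^ (-(ν 0 : ℝ)) * d ^ (-(ν 1 : ℝ)) *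
        n ^ (-(ν 2 : ℝ)) * r ^ (-(ν 3 : ℝ)) * s ^ (-(ν 4 : ℝ))) ^ (1 - ε₀))
    {v : ℝ} (hv0 : 0 ≤ v) (hv2 : v ≤ 2) (j : ℤ) {k : ℕ} (hk : k ≤ 60) (y : R5) :
    ‖iteratedFDeriv ℝ k (fun y => U5 (weightW g C D N R S v j)
        (scale5 ![C, sqrtTwoScale j, N, R, S] y)) y‖ ≤
      K * kappaW * (32 * C * D * N * R * S) ^ (60 * ε₀) := by
  have hC0 : 0 < C := by linarith
  have hD0 : 0 < D := by linarith
  have hN0 : 0 < N := by linarith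
  have hR0 : 0 < R := by linarith
  have hS0 : 0 < S := by linarith
  have hM := sqrtTwoScale_pos j
  set M := sqrtTwoScale j with hMdef
  set b : R5 := ![C, D, N, R, S] with hb
  set P : ℝ := 32 * C * D * N * R * S with hP
  have hP1 : 1 ≤ P := by
    have : (16 : ℝ) ≤ P := by
      rw [hP]
      have h1 : (1 : ℝ) * 1 ≤ C * D := mul_le_mul hC hD zero_le_one hC0.le
      have h2 : (1 : ℝ) * 1 ≤ R * S := mul_le_mul hR hS zero_le_one hR0.le
      nlinarith [mul_le_mul h1 h2 (by norm_num) (by positivity)]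
    linarith
  have hbpos : ∀ i, 0 < b i := by
    intro i; fin_cases i <;> simp [hb] <;> assumption
  have hbP : ∀ i, b i ≤ P := by
    have hle : ∀ x : ℝ, 0 < x → x ≤ P → x ≤ P := fun x _ h => h
    -- each scale is at most `P = (2C)(2D)(2N)(2R)(2S)` since every factor `2X ≥ 1`
    have e : P = (2 * C) * (2 * D) * (2 * N) * (2 * R) * (2 * S) := by rw [hP]; ring
    have f1 : (1 : ℝ) ≤ 2 * C := by linarith
    have f2 : (1 : ℝ) ≤ 2 * D := by linarith
    have f3 : (1 : ℝ) ≤ 2 * N := by linarith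
    have f4 : (1 : ℝ) ≤ 2 * R := by linarith
    have f5 : (1 : ℝ) ≤ 2 * S := by linarith
    intro i
    fin_cases i <;> simp [hb] <;> rw [e] <;>
      nlinarith [one_le_mul_of_one_le_of_one_le f1 f2, one_le_mul_of_one_le_of_one_le f4 f5,
        one_le_mul_of_one_le_of_one_le (one_le_mul_of_one_le_of_one_le f1 f2) f3,
        one_le_mul_of_one_le_of_one_le (one_le_mul_of_one_le_of_one_le f1 f2)
          (one_le_mul_of_one_le_of_one_le f4 f5),
        mul_nonneg (mul_nonneg (by linarith : (0:ℝ) ≤ 2 * C) (by linarith : (0:ℝ) ≤ 2 * D))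
          (by linarith : (0:ℝ) ≤ 2 * N)]
  -- the rescaled weight as a product
  set F1 : R5 → ℂ := fun y =>
    ((sqrtTwoBump j (M * y 1) * cutU (y 2) * cutU (y 3) * cutU (y 4) : ℝ) : ℂ) with hF1
  set gflat : R5 → ℂ := fun z => U5 g (scale5 b z) with hgflat
  set F2 : R5 → ℂ := fun y => gflat (PhiV v y) with hF2
  have hFn : (fun y => U5 (weightW g C D N R S v j) (scale5 ![C, M, N, R, S] y)) =
      fun y => F1 y * F2 y := by
    funext y
    simp only [hF1, hF2, hgflat, U5, weightW, scale5_apply, hb, PhiV_apply_zero, PhiV_apply_one,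
      PhiV_apply_two, PhiV_apply_three, PhiV_apply_four, Matrix.cons_val_zero, Matrix.cons_val_one,
      Matrix.cons_val]
    rw [mul_div_cancel_left₀ _ hN0.ne', mul_div_cancel_left₀ _ hR0.ne',
      mul_div_cancel_left₀ _ hS0.ne']
    congr 2
    field_simp
  have sF1 : ContDiff ℝ ∞ F1 := by
    have hb' : ContDiff ℝ ∞ (fun t => sqrtTwoBump j (M * t)) :=
      (contDiff_sqrtTwoBump j).comp (contDiff_const.mul contDiff_id)
    have hreal : ContDiff ℝ ∞ (fun y : R5 => sqrtTwoBump j (M * y 1) * cutU (y 2) * cutU (y 3) *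
        cutU (y 4)) :=
      (((hb'.comp (contDiff_apply ℝ ℝ 1)).mul (contDiff_cutU.comp (contDiff_apply ℝ ℝ 2))).mul
        (contDiff_cutU.comp (contDiff_apply ℝ ℝ 3))).mul (contDiff_cutU.comp (contDiff_apply ℝ ℝ 4))
    exact Complex.ofRealCLM.contDiff.comp hreal
  have sgflat : ContDiff ℝ ∞ gflat := contDiff_comp_scale5 hg b
  have sF2 : ContDiff ℝ ∞ F2 := sgflat.comp (contDiff_PhiV v)
  rw [hFn]
  -- the box outside which the rescaled weight vanishes identically
  set Box : Set R5 := {y : R5 | y 0 ∈ Set.Icc (1 : ℝ) 2 ∧ y 1 ∈ Set.Icc (1 : ℝ) 2 ∧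
      y 2 ∈ Set.Icc (1 / 2 : ℝ) (5 / 2) ∧ y 3 ∈ Set.Icc (1 / 2 : ℝ) (5 / 2) ∧
      y 4 ∈ Set.Icc (1 / 2 : ℝ) (5 / 2) ∧ v * y 0 * y 4 ∈ Set.Icc (1 : ℝ) 2} with hBox
  have hBoxClosed : IsClosed Box := by
    have c0 : IsClosed {y : R5 | y 0 ∈ Set.Icc (1 : ℝ) 2} :=
      isClosed_Icc.preimage (continuous_apply 0)
    have c1 : IsClosed {y : R5 | y 1 ∈ Set.Icc (1 : ℝ) 2} :=
      isClosed_Icc.preimage (continuous_apply 1)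
    have c2 : IsClosed {y : R5 | y 2 ∈ Set.Icc (1 / 2 : ℝ) (5 / 2)} :=
      isClosed_Icc.preimage (continuous_apply 2)
    have c3 : IsClosed {y : R5 | y 3 ∈ Set.Icc (1 / 2 : ℝ) (5 / 2)} :=
      isClosed_Icc.preimage (continuous_apply 3)
    have c4 : IsClosed {y : R5 | y 4 ∈ Set.Icc (1 / 2 : ℝ) (5 / 2)} :=
      isClosed_Icc.preimage (continuous_apply 4)
    have c5 : IsClosed {y : R5 | v * y 0 * y 4 ∈ Set.Icc (1 : ℝ) 2} :=
      isClosed_Icc.preimage ((continuous_const.mul (continuous_apply 0)).mul (continuous_apply 4))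
    rw [hBox]
    exact c0.and (c1.and (c2.and (c3.and (c4.and c5))))
  have hRHS : 0 ≤ K * kappaW * P ^ (60 * ε₀) := by
    have := kappaW_nonneg
    have : 0 ≤ P ^ (60 * ε₀) := Real.rpow_nonneg (by linarith) _
    positivity
  by_cases hy : y ∈ Box
  · -- inside the box: Leibniz + Faà di Bruno
    rw [hBox, Set.mem_setOf_eq] at hy
    obtain ⟨hy0, hy1, hy2, hy3, hy4, hyv⟩ := hy
    have A1 := norm_iteratedFDeriv_cutFactor_rescaled_le j y
    -- `F2` through `Φ_v`
    have hz : ∀ i, 1 / 2 ≤ PhiV v y i := by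
      intro i
      fin_cases i
      · simp; linarith [hy0.1]
      · simp; linarith [hyv.1]
      · simp; linarith [hy2.1]
      · simp; linarith [hy3.1]
      · simp; linarith [hy4.1]
    have hCg : ∀ i, i ≤ 60 → ‖iteratedFDeriv ℝ i gflat (PhiV v y)‖ ≤ K * 10 ^ 60 * P ^ (60 * ε₀) :=
      fun i hi => norm_iteratedFDeriv_gflat_le hg hbpos hP1 hbP hK hε₀ hε₁ hder hz hi
    have hDφ : 2 + |v| * (|y 0| + |y 4| + 2) ≤ 15 := by
      rw [abs_of_nonneg hv0, abs_of_nonneg (by linarith [hy0.1] : (0:ℝ) ≤ y 0),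
        abs_of_nonneg (by linarith [hy4.1] : (0:ℝ) ≤ y 4)]
      nlinarith [hy0.2, hy4.2]
    have hDφ1 : (1 : ℝ) ≤ 2 + |v| * (|y 0| + |y 4| + 2) := by
      have : 0 ≤ |v| * (|y 0| + |y 4| + 2) := by positivity
      linarith
    have hPe : 0 ≤ P ^ (60 * ε₀) := Real.rpow_nonneg (zero_le_one.trans hP1) _
    have hCg0 : 0 ≤ K * 10 ^ 60 * P ^ (60 * ε₀) := mul_nonneg (mul_nonneg hK (by norm_num)) hPe
    have A2 : ∀ i, i ≤ 60 → ‖iteratedFDeriv ℝ i F2 y‖ ≤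
        (Nat.factorial 60 : ℝ) * (K * 10 ^ 60 * P ^ (60 * ε₀)) * 15 ^ 60 := by
      intro i hi
      have h := norm_iteratedFDeriv_comp_PhiV_le sgflat v y (n := i)
        (Cg := K * 10 ^ 60 * P ^ (60 * ε₀)) (fun l hl => hCg l (hl.trans hi))
      refine h.trans ?_
      have hfac : (Nat.factorial i : ℝ) ≤ Nat.factorial 60 := by
        exact_mod_cast Nat.factorial_le hi
      have hpow : (2 + |v| * (|y 0| + |y 4| + 2)) ^ i ≤ 15 ^ 60 :=
        calc (2 + |v| * (|y 0| + |y 4| + 2)) ^ i ≤ 15 ^ i :=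
              pow_le_pow_left₀ (by positivity) hDφ i
          _ ≤ 15 ^ 60 := pow_le_pow_right₀ (by norm_num) hi
      have h15 : 0 ≤ (2 + |v| * (|y 0| + |y 4| + 2)) ^ i := pow_nonneg (by linarith) i
      exact mul_le_mul (mul_le_mul_of_nonneg_right hfac hCg0) hpow h15
        (mul_nonneg (Nat.cast_nonneg _) hCg0)
    have hA1 : 0 ≤ 8 ^ 60 * betaBump * betaCut ^ 3 := by
      have := betaBump_nonneg; have := one_le_betaCut; positivity
    have hA2 : 0 ≤ (Nat.factorial 60 : ℝ) * (K * 10 ^ 60 * P ^ (60 * ε₀)) * 15 ^ 60 :=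
      mul_nonneg (mul_nonneg (Nat.cast_nonneg _) hCg0) (by norm_num)
    have prod := norm_iteratedFDeriv_mul_le_of_le sF1 sF2 hA1 hA2 A1 A2 k hk
    refine prod.trans (le_of_eq ?_)
    rw [kappaW]
    ring
  · -- outside the box the rescaled weight vanishes near `y`
    have hsupp' : Function.support (fun y => F1 y * F2 y) ⊆ Box := by
      intro y' hy'
      have hne : U5 (weightW g C D N R S v j) (scale5 ![C, M, N, R, S] y') ≠ 0 := by
        rw [congrFun hFn y']
        exact Function.mem_support.mp hy'
      rw [hBox, Set.mem_setOf_eq]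
      exact rescaled_weightW_ne_zero (v := v) (j := j) hC0 hD0 hN0 hR0 hS0 hsupp hne
    have hts : tsupport (fun y => F1 y * F2 y) ⊆ Box := closure_minimal hsupp' hBoxClosed
    have hy' : y ∉ tsupport (fun y => F1 y * F2 y) := fun h => hy (hts h)
    rw [notMem_tsupport_iff_eventuallyEq] at hy'
    have h0 := (hy'.iteratedFDeriv ℝ k).self_of_nhds
    rw [h0, iteratedFDeriv_zero, Pi.zero_apply, norm_zero]
    exact hRHS

/-- **The derivative conditions (4.29) for `W_{v,j}` (Proposition 4.13's hypothesis), with the loss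
`Λ = K · κ_W · (32 CDNRS)^{60ε₀}`**: for every `ν` with `νᵢ ≤ 12`,
`‖∂^ν W_{v,j}(c,h,n,r,s)‖ ≤ Λ / (C^{ν₀} a_j^{ν₁} N^{ν₂} R^{ν₃} S^{ν₄})`. [cite: Drappeau2017, §4.3.3] -/
theorem norm_mixedDeriv_weightW_le {g : ℝ → ℝ → ℝ → ℝ → ℝ → ℂ}
    (hg : ContDiff ℝ ∞ (U5 g)) {C D N R S : ℝ} (hC : 1 ≤ C) (hD : 1 ≤ D) (hN : 1 / 2 ≤ N)
    (hR : 1 ≤ R) (hS : 1 ≤ S)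
    (hsupp : ∀ c d n r s, g c d n r s ≠ 0 → C < c ∧ c ≤ 2 * C ∧ D < d ∧ d ≤ 2 * D)
    {K ε₀ : ℝ} (hK : 0 ≤ K) (hε₀ : 0 ≤ ε₀) (hε₁ : ε₀ ≤ 1)
    (hder : ∀ ν : Fin 5 → ℕ, (∀ i, ν i ≤ 60) → ∀ c d n r s : ℝ, 0 < c → 0 < d → 0 < n → 0 < r →
      0 < s → ‖mixedDeriv ν g c d n r s‖ ≤ K * (c ^ (-(ν 0 : ℝ)) * d ^ (-(ν 1 : ℝ)) *
        n ^ (-(ν 2 : ℝ)) * r ^ (-(ν 3 : ℝ)) * s ^ (-(ν 4 : ℝ))) ^ (1 - ε₀))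
    {v : ℝ} (hv0 : 0 ≤ v) (hv2 : v ≤ 2) (j : ℤ) (ν : Fin 5 → ℕ) (hν : ∀ i, ν i ≤ 12)
    (c h n r s : ℝ) :
    ‖mixedDeriv ν (weightW g C D N R S v j) c h n r s‖ ≤
      K * kappaW * (32 * C * D * N * R * S) ^ (60 * ε₀) /
        (C ^ ν 0 * sqrtTwoScale j ^ ν 1 * N ^ ν 2 * R ^ ν 3 * S ^ ν 4) := by
  have hC0 : 0 < C := by linarith
  have hN0 : 0 < N := by linarith
  have hR0 : 0 < R := by linarith
  have hS0 : 0 < S := by linarith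
  have hM := sqrtTwoScale_pos j
  set a : R5 := ![C, sqrtTwoScale j, N, R, S] with ha
  have hapos : ∀ i, 0 < a i := by intro i; fin_cases i <;> simp [ha] <;> assumption
  have hW : ContDiff ℝ ∞ (U5 (weightW g C D N R S v j)) := contDiff_U5_weightW hg C D N R S v j
  have hk : ν 0 + ν 1 + ν 2 + ν 3 + ν 4 ≤ 60 := by
    have := hν 0; have := hν 1; have := hν 2; have := hν 3; have := hν 4; omega
  have h1 := norm_mixedDeriv_le_rescaled hW a hapos ν rfl ![c, h, n, r, s]
  simp only [Matrix.cons_val_zero, Matrix.cons_val_one, Matrix.cons_val] at h1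
  refine h1.trans ?_
  have h2 := norm_iteratedFDeriv_rescaled_weightW_le hg hC hD hN hR hS hsupp hK hε₀ hε₁ hder hv0 hv2
    j hk (fun i => (a i)⁻¹ * (![c, h, n, r, s] : R5) i)
  rw [div_eq_inv_mul]
  have hden : a 0 ^ ν 0 * a 1 ^ ν 1 * a 2 ^ ν 2 * a 3 ^ ν 3 * a 4 ^ ν 4 =
      C ^ ν 0 * sqrtTwoScale j ^ ν 1 * N ^ ν 2 * R ^ ν 3 * S ^ ν 4 := by
    simp [ha]
  rw [← hden]
  refine mul_le_mul_of_nonneg_left ?_ (by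
    have := hapos 0; have := hapos 1; have := hapos 2; have := hapos 3; have := hapos 4
    positivity)
  convert h2 using 2

end KloostermanQuintilinear

end Literature.NumberTheory.Sieve

end
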